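import Literature.Barriers.CriticalPhenomena.PlaquetteWalkHoleRootSevenAboveFrameData
import Literature.Barriers.CriticalPhenomena.PlaquetteWalkAngleLimitAboveCriterion
import Literature.Barriers.CriticalPhenomena.PlaquetteWalkHoleRootExtensionClasses
import HarnessLib

/-!
# Barrier catalogue (SAWScalingLimit): the turn classes and the PHASE of the cost-`7` parents above the root row, end side `E` («COLUMN LAW», classes)

`Z → ∞` limit model of the printed Yang–Baxter weights [GlazmanManolescu2019, §1, eq. (1)]; the «RECTANGLE COEFFICIENT» line of the venture lane «pcv-sawmu»
(b-engine-1 g27). From the frame data (`ΩG.frame_of_cost_seven_E_above`: prefix = root-row run, left turn `W → N` at `p₁`, straight climb; every kiss is `p₁`,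
with arcs `W → N`, `S → E`) and the rigid excursion winding (`ΩG.excursion_quarterTurns_of_wound`, `woundTurns S W E = 4`), the signed quarter turns of such a
parent are `q = 6` (★ `ΩG.quarterTurnsL_of_cost_seven_E_above`), and the turn bookkeeping of `PlaquetteWalkAngleLimitPhase` (`q = n_HL + n_VL − n_HR − n_VR`,
`n_HL + n_HR = n_VL + n_VR` between vertical ends, `n_HL + n_VR = n_u₁ + 2n_w₁`, `n_HR + n_VL = n_u₂ + 2n_w₂`, `n_u₁ + n_u₂ = 6`) leaves exactly the census
classes ★★★ `ΩG.classes_of_cost_seven_E_above`: `(n_HL, n_VL, n_HR, n_VR; n_w₁, n_w₂) = (3,3,0,0; 0,0)` or `(4,3,0,1; 1,0)` (FINDING-YB-LEVEL5-PHASE-LAW: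
`(E,3,3,ε,0,+6)`). Hence ★★★ `ΩG.phaseIndex_ext₃_of_cost_seven_E_above`: the class-`B2b` member `ext₃ ω` (one more arc `E → N` in `r`, a second `(π−θ)`-corner
there) has PHASE INDEX `3` (`ε = 0`) or `6` (`ε = 1`) — the `E`-half of the hypothesis `hphase` of `vertexFunctional_printed_zero_set_finite_above_of_phase`.
[GlazmanManolescu2019 §1 Fig. 1, eq. (1), Lemma 2.1 (eq. (CR)), Remark 2.2; Glazman2015WeightedSAW Lemma 3.1 (proof, pp. 6–7); Hopf1935 Nr. 2]
-/

noncomputable section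

open private IsNS fc_fh from Literature.Probability.RandomPlanarGeometry.YangBaxterSAWGeneralDomain

namespace Literature.Probability.RandomPlanarGeometry.SAW.YangBaxter

open Real
open Literature.Barriers.CriticalPhenomena.PlaquetteWalk

namespace YBWalk

variable {D : Set Face} {a z : MidEdge} (γ : YBWalk D a z)

/-- The entry/exit side pair of the `m`-th arc. [cite: GlazmanManolescu2019, §1, Fig. 1 (the arcs of a walk inside a rhombus)] -/
theorem arcSides_getElem {m : ℕ} (hm : m < γ.arcs.length) : arcSides γ.arcs[m] = some (γ.sIn m, γ.sOut m) := by
  obtain ⟨h1, h2, h3⟩ := YBWalk.side_sIn hm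
  rw [γ.getElem_arcs hm, ← h1, ← h2]
  simp [arcSides, arcFace_side_side _ _ _ h3, Face.sideOf_side]

/-- A kind listed for a plaquette is the kind of an arc drawn in it. [cite: GlazmanManolescu2019, §1, Fig. 1] -/
theorem exists_arc_of_mem_kindsL {f : Face} {κ : ArcKind} (h : κ ∈ kindsL γ.mids f) :
    ∃ m < γ.arcs.length, γ.fc m = f ∧ arcKind (γ.sIn m) (γ.sOut m) = κ := by
  unfold kindsL at h
  obtain ⟨p, hp, hpk⟩ := List.mem_filterMap.1 h
  obtain ⟨m, hm, rfl⟩ := List.getElem_of_mem hp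
  obtain ⟨hfa, hk⟩ := γ.arcKindOf_getElem hm
  by_cases hf : arcFace γ.arcs[m] = some f
  · rw [if_pos hf, hk] at hpk
    refine ⟨m, hm, ?_, by simpa using hpk⟩
    rw [hfa] at hf; simpa using hf
  · rw [if_neg hf] at hpk; exact absurd hpk (by simp)

/-- ★ **QUARTER TURNS OF A WALK WITH ONE TURN BEFORE AN INDEX**: if among the arcs `0, …, m` only the arc `k < m` and the arc `m` turn, the quarter turns from any
index `i ≤ m` on are `[i ≤ k]·qTurn_k + qTurn_m + (quarter turns after m)`. [cite: GlazmanManolescu2019, §2.1 (the winding of a walk); lane plumbing] -/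
theorem sum_qTurnOf_drop_of_one_turn {k m : ℕ} (hm : m < γ.arcs.length) (hkm : k < m)
    (hstr : ∀ i < m, i ≠ k → arcKind (γ.sIn i) (γ.sOut i) = .straight) :
    ∀ i ≤ m, ((γ.arcs.drop i).map qTurnOf).sum =
      (if i ≤ k then qTurn (γ.sIn k) (γ.sOut k) else 0) + qTurn (γ.sIn m) (γ.sOut m) + ((γ.arcs.drop (m + 1)).map qTurnOf).sum := by
  suffices H : ∀ d i : ℕ, i + d = m → ((γ.arcs.drop i).map qTurnOf).sum =
      (if i ≤ k then qTurn (γ.sIn k) (γ.sOut k) else 0) + qTurn (γ.sIn m) (γ.sOut m) + ((γ.arcs.drop (m + 1)).map qTurnOf).sum by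
    intro i hi; exact H (m - i) i (by omega)
  intro d
  induction d with
  | zero =>
    intro i hi
    rw [Nat.add_zero] at hi
    subst hi
    rw [List.drop_eq_getElem_cons hm, List.map_cons, List.sum_cons, γ.qTurnOf_getElem hm, if_neg (by omega)]
    ring
  | succ d ih =>
    intro i hi
    have hi' : i < γ.arcs.length := by omega
    rw [List.drop_eq_getElem_cons hi', List.map_cons, List.sum_cons, ih (i + 1) (by omega), γ.qTurnOf_getElem hi']
    rcases lt_trichotomy i k with hlt | heq | hgt
    · have h0 : qTurn (γ.sIn i) (γ.sOut i) = 0 := by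
        have := (qTurn_ne_zero_iff (γ.sIn_ne_sOut hi')).not; push Not at this
        exact this.2 (hstr i (by omega) (by omega))
      rw [h0, if_pos (by omega), if_pos (by omega)]; ring
    · subst heq
      rw [if_pos le_rfl, if_neg (by omega)]; ring
    · have h0 : qTurn (γ.sIn i) (γ.sOut i) = 0 := by
        have := (qTurn_ne_zero_iff (γ.sIn_ne_sOut hi')).not; push Not at this
        exact this.2 (hstr i (by omega) (by omega))
      rw [h0, if_neg (by omega), if_neg (by omega)]; ring

end YBWalk

namespace ΩG

variable {D : Set Face} {w r : Face} {ω : ΩG D (w.side .W) r}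

/-- ★ **THE COST-`7` PARENTS ABOVE THE ROW WIND SIX QUARTER TURNS** (end side `E`): `q(ω) = 6` — one left turn at `p₁`, one at `r` (`S → W`), and the four of the
wound excursion (`woundTurns S W E = 4`). [cite: GlazmanManolescu2019, §2.1 (the winding); Lemma 2.1 (statement, «in the form given in [Gl]»)]
[cite: Glazman2015WeightedSAW, Lemma 3.1 (proof, pp. 6–7)] [cite: Hopf1935, Nr. 2 (Umlaufsatz, p. 53)] -/
theorem quarterTurnsL_of_cost_seven_E_above (hh : holeFaceW w ∉ D) (hr : RootedFace D (w.side .W) r) (h : ω.IsB2a)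
    (hA : ω.AJ hr h (toC (midPt (w.side .W))) ≠ 0) (hc : cost (slotOfSide ω.1) ω.2.mids = 7) (hE : ω.1 = .E)
    (hNS : arcKind (ω.2.sIn ω.2.firstHitG) (ω.2.sOut ω.2.firstHitG) ≠ .straight) (habove : w.2 < r.2) (hcol : w.1 ≤ r.1)
    {k : ℕ} (hk : k < ω.2.arcs.length) (hstrk : ∀ i < k, arcKind (ω.2.sIn i) (ω.2.sOut i) = .straight)
    (hturnk : arcKind (ω.2.sIn k) (ω.2.sOut k) ≠ .straight) : quarterTurnsL ω.2.mids = 6 := by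
  obtain ⟨hWk, hkN, hkF, hstr', -⟩ := frame_of_cost_seven_E_above hh hr h hA hc hE hNS habove hcol hk hstrk hturnk
  obtain ⟨hSin, hWout⟩ := sIn_firstHit_eq_S_of_cost_seven_E_above hh hr h hA hc hE hNS habove hcol
  have hF := ω.fh_lt h
  obtain ⟨-, hf2, hf3⟩ := fc_fh' ω hr h
  have hexc := excursion_quarterTurns_of_wound hr h hA
  have hwt : woundTurns Side.S Side.W ω.1 = 4 := by rw [hE]; rfl
  rw [← hf2, ← hf3, hSin, hWout, hwt] at hexc
  have hsum := ω.2.sum_qTurnOf_drop_of_one_turn hF hkF hstr' 0 (Nat.zero_le _)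
  rw [List.drop_zero, if_pos (Nat.zero_le _), hWk, hkN, hSin, hWout, hexc] at hsum
  unfold quarterTurnsL
  change ((ω.2.arcs).map qTurnOf).sum = 6
  rw [hsum]; rfl

/-- ★★★ **THE TURN CLASSES OF THE COST-`7` PARENTS ABOVE THE ROOT ROW** (end side `E`): `(n_HL, n_VL, n_HR, n_VR) = (3, 3, 0, 0)` with no doubly visited plaquette, or
`(4, 3, 0, 1)` with exactly one, a `w₁` plaquette (census classes `(E,3,3,ε,0,+6)`); in particular `n_VL = 3`, `n_w₂ = 0`, `n_w₁ ≤ 1`.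
[cite: GlazmanManolescu2019, §1, Fig. 1 and eq. (1); Lemma 2.1; Remark 2.2] [cite: Glazman2015WeightedSAW, Lemma 3.1 (proof, pp. 6–7)] -/
theorem classes_of_cost_seven_E_above (hh : holeFaceW w ∉ D) (hr : RootedFace D (w.side .W) r) (h : ω.IsB2a)
    (hA : ω.AJ hr h (toC (midPt (w.side .W))) ≠ 0) (hc : cost (slotOfSide ω.1) ω.2.mids = 7) (hE : ω.1 = .E)
    (hNS : arcKind (ω.2.sIn ω.2.firstHitG) (ω.2.sOut ω.2.firstHitG) ≠ .straight) (habove : w.2 < r.2) (hcol : w.1 ≤ r.1)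
    {k : ℕ} (hk : k < ω.2.arcs.length) (hstrk : ∀ i < k, arcKind (ω.2.sIn i) (ω.2.sOut i) = .straight)
    (hturnk : arcKind (ω.2.sIn k) (ω.2.sOut k) ≠ .straight) :
    vlCount ω.2.mids = 3 ∧ hrCount ω.2.mids = 0 ∧ cfgCount ω.2.mids [.coCorner, .coCorner] = 0 ∧
      ((hlCount ω.2.mids = 3 ∧ vrCount ω.2.mids = 0 ∧ cfgCount ω.2.mids [.corner, .corner] = 0) ∨
        (hlCount ω.2.mids = 4 ∧ vrCount ω.2.mids = 1 ∧ cfgCount ω.2.mids [.corner, .corner] = 1)) := by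
  classical
  obtain ⟨hWk, hkN, hkF, -, hkiss⟩ := frame_of_cost_seven_E_above hh hr h hA hc hE hNS habove hcol hk hstrk hturnk
  have hq6 := quarterTurnsL_of_cost_seven_E_above hh hr h hA hc hE hNS habove hcol hk hstrk hturnk
  set n := ω.2.arcs.length with hn
  -- the bookkeeping identities
  have hq := quarterTurnsL_eq_classes ω.2.mids
  have htel := hvCount_sub_vhCount_walk ω.2
  obtain ⟨hhv, hvh⟩ := hvCount_eq ω.2
  have hz : vertB (r.side ω.1) = true := by rw [hE]; exact (vertB_side r).2.1
  rw [hhv, hvh, (vertB_side w).1, hz] at htel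
  have hc1 := countP_corner_eq ω.2.mids
  rw [countP_corner_eq_cfgCount ω.2] at hc1
  have hc2 := countP_coCorner_eq ω.2.mids
  rw [countP_coCorner_eq_cfgCount ω.2] at hc2
  have hd : slotDeg (slotOfSide ω.1) = 0 := by rw [hE]; rfl
  have h6 : cfgCount ω.2.mids [.corner] + cfgCount ω.2.mids [.coCorner] = 6 := by
    have hcost : cost (slotOfSide ω.1) ω.2.mids =
        cfgCount ω.2.mids [.corner] + cfgCount ω.2.mids [.coCorner] + (1 - slotDeg (slotOfSide ω.1)) := rfl
    rw [hcost, hd] at hc; omega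
  -- the kisses: none, or exactly `p₁` as a `w₁` plaquette with a `VR` arc
  have hsingle : ∀ m < n, (∀ j < n, ω.2.fc j = ω.2.fc m → j = m) → ∀ κ : ArcKind, kindsL ω.2.mids (ω.2.fc m) ≠ [κ, κ] := by
    intro m hm hsv κ e
    rw [ω.2.kindsL_eq_singleton_of_single_visit hm hsv] at e
    exact absurd (congrArg List.length e) (by simp)
  have hw2 : cfgCount ω.2.mids [.coCorner, .coCorner] = 0 := by
    unfold cfgCount
    rw [List.countP_eq_zero]
    intro f hf hkf
    obtain ⟨m, hm, rfl⟩ := ω.2.exists_fc_eq_of_mem_facesL hf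
    have hkf' : kindsL ω.2.mids (ω.2.fc m) = [.coCorner, .coCorner] := by simpa using hkf
    by_cases hsv : ∀ j < n, ω.2.fc j = ω.2.fc m → j = m
    · exact hsingle m hm hsv _ hkf'
    · push Not at hsv
      obtain ⟨j, hj, hfj, hjm⟩ := hsv
      obtain ⟨-, hsides⟩ := hkiss m j hm hj hfj.symm (Ne.symm hjm)
      obtain ⟨l, hl, hfl, hkl⟩ := ω.2.exists_arc_of_mem_kindsL (show ArcKind.coCorner ∈ kindsL ω.2.mids (ω.2.fc m) by rw [hkf']; simp)
      rcases ω.2.eq_or_eq_of_fc_eq_three hm hj hl (Ne.symm hjm) hfj hfl with rfl | rfl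
      · rcases hsides with ⟨h1, h2, -, -⟩ | ⟨h1, h2, -, -⟩ <;> rw [h1, h2] at hkl <;> exact absurd hkl (by decide)
      · rcases hsides with ⟨-, -, h1, h2⟩ | ⟨-, -, h1, h2⟩ <;> rw [h1, h2] at hkl <;> exact absurd hkl (by decide)
  have hw1 : cfgCount ω.2.mids [.corner, .corner] ≤ 1 := by
    unfold cfgCount
    calc (facesL ω.2.mids).countP (fun f => kindsL ω.2.mids f = [.corner, .corner])
        ≤ (facesL ω.2.mids).countP (fun f => f = (w.1 + k, w.2)) := by
          refine List.countP_mono_left fun f hf hkf => ?_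
          obtain ⟨m, hm, rfl⟩ := ω.2.exists_fc_eq_of_mem_facesL hf
          have hkf' : kindsL ω.2.mids (ω.2.fc m) = [.corner, .corner] := by simpa using hkf
          by_cases hsv : ∀ j < n, ω.2.fc j = ω.2.fc m → j = m
          · exact absurd hkf' (hsingle m hm hsv _)
          · push Not at hsv
            obtain ⟨j, hj, hfj, hjm⟩ := hsv
            obtain ⟨hp, -⟩ := hkiss m j hm hj hfj.symm (Ne.symm hjm)
            simpa using hp
      _ = (facesL ω.2.mids).count ((w.1 + k, w.2) : Face) := by rw [List.count_eq_countP]; exact List.countP_congr fun f _ => by simp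
      _ ≤ 1 := List.nodup_iff_count_le_one.1 (by unfold facesL; exact List.nodup_dedup _) _
  have hvr : cfgCount ω.2.mids [.corner, .corner] = 0 ∨ 1 ≤ vrCount ω.2.mids := by
    by_cases hinj : ∀ i j, i < n → j < n → ω.2.fc i = ω.2.fc j → i = j
    · exact Or.inl (ω.2.pairs_eq_zero_of_injective hinj).1
    · right
      push Not at hinj
      obtain ⟨i, j, hi, hj, hfij, hij⟩ := hinj
      obtain ⟨-, hsides⟩ := hkiss i j hi hj hfij hij
      obtain ⟨l, hl, hSl, hEl⟩ : ∃ l < n, ω.2.sIn l = .S ∧ ω.2.sOut l = .E := by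
        rcases hsides with ⟨-, -, h1, h2⟩ | ⟨h1, h2, -, -⟩
        · exact ⟨j, hj, h1, h2⟩
        · exact ⟨i, hi, h1, h2⟩
      unfold vrCount classCount
      refine List.countP_pos_iff.2 ⟨ω.2.arcs[l], List.getElem_mem hl, ?_⟩
      rw [ω.2.arcSides_getElem hl, hSl, hEl]; rfl
  refine ⟨by omega, by omega, hw2, ?_⟩
  rcases hvr with h0 | h1
  · left; refine ⟨?_, ?_, h0⟩ <;> omega
  · rcases Nat.lt_or_ge 0 (cfgCount ω.2.mids [.corner, .corner]) with hpos | hzero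
    · right; refine ⟨?_, ?_, by omega⟩ <;> omega
    · left; refine ⟨?_, ?_, by omega⟩ <;> omega

/-- ★★★ **THE CLASS-`B2b` MEMBERS ABOVE THE ROOT ROW WITH AN `E`-PARENT HAVE PHASE INDEX `3` OR `6`.** For a wound class-`B2a` walk of limit cost `7` at a rhombus
`r` strictly above the root row with `w.1 ≤ r.1`, ending on the `E` side of `r` with a turning first arc, the extension `ext₃ ω` (which ends on `N`,
`ΩG.ext₃_fst_eq_N_of_above`) has `phaseIndex = 3` (no kiss) or `6` (the kiss at `p₁`). [cite: GlazmanManolescu2019, §1, Fig. 1 and eq. (1); Lemma 2.1, eq. (CR); Remark 2.2]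
[cite: Glazman2015WeightedSAW, Lemma 3.1 (proof, pp. 6–7)] -/
theorem phaseIndex_ext₃_of_cost_seven_E_above (hh : holeFaceW w ∉ D) (hr : RootedFace D (w.side .W) r) (h : ω.IsB2a)
    (hA : ω.AJ hr h (toC (midPt (w.side .W))) ≠ 0) (hc : cost (slotOfSide ω.1) ω.2.mids = 7) (hE : ω.1 = .E)
    (hNS : arcKind (ω.2.sIn ω.2.firstHitG) (ω.2.sOut ω.2.firstHitG) ≠ .straight) (habove : w.2 < r.2) (hcol : w.1 ≤ r.1) :
    phaseIndex (ω.ext₃ hr).2.mids = 3 ∨ phaseIndex (ω.ext₃ hr).2.mids = 6 := by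
  -- the first turn
  have hk₁ex : ∃ k, arcKind (ω.2.sIn k) (ω.2.sOut k) ≠ .straight := ⟨_, hNS⟩
  have hkF : Nat.find hk₁ex ≤ ω.2.firstHitG := Nat.find_min' hk₁ex hNS
  have hk : Nat.find hk₁ex < ω.2.arcs.length := lt_of_le_of_lt hkF (ω.fh_lt h)
  have hstrk : ∀ i < Nat.find hk₁ex, arcKind (ω.2.sIn i) (ω.2.sOut i) = .straight := by
    intro i hi; by_contra hne; exact Nat.find_min hk₁ex hi hne
  have hturnk : arcKind (ω.2.sIn (Nat.find hk₁ex)) (ω.2.sOut (Nat.find hk₁ex)) ≠ .straight := Nat.find_spec hk₁ex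
  obtain ⟨hvl, -, hw2, hcases⟩ := classes_of_cost_seven_E_above hh hr h hA hc hE hNS habove hcol hk hstrk hturnk
  obtain ⟨hSin, hWout⟩ := sIn_firstHit_eq_S_of_cost_seven_E_above hh hr h hA hc hE hNS habove hcol
  obtain ⟨-, hsInF, hsOutF⟩ := fc_fh ω hr h
  have hN : IsNS ω hr := ⟨h, by rw [← hsInF, ← hsOutF]; exact hNS⟩
  obtain ⟨-, hf2, hf3⟩ := fc_fh' ω hr h
  obtain ⟨hz3, hvl', -, hco⟩ := ext₃_phase_data hr hN
  have hkind : arcKind ω.2.firstSideG (ω.z1 hr h) = .coCorner := by rw [← hf2, ← hf3, hSin, hWout]; rfl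
  obtain ⟨hco1, hco2⟩ := hco hkind
  have hz3N : (ω.ext₃ hr).1 = .N := ext₃_fst_eq_N_of_above hh hr h hA hc (Or.inl hE) hNS habove
  rw [hz3] at hz3N
  rw [hz3N] at hvl'
  have hVL : (if isVL (ω.1, Side.N) = true then 1 else 0) = 0 := by rw [hE]; rfl
  rw [hVL, add_zero] at hvl'
  unfold phaseIndex
  rw [hvl', hco1, hco2, hvl, hw2]
  rcases hcases with ⟨-, -, h0⟩ | ⟨-, -, h1⟩
  · left; rw [h0]
  · right; rw [h1]

end ΩG

end Literature.Probability.RandomPlanarGeometry.SAW.YangBaxter
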